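import Summits.BirchSwinnertonDyer.BirchSwinnertonDyer.Theorems.KatoDescentPotSupersingularWildFineSelmerCentralLayerL11Records01
import Summits.BirchSwinnertonDyer.BirchSwinnertonDyer.Theorems.KatoDescentPotSupersingularWildUpperUnitTwistRecordsClassO626
import Literature.NumberTheory.EllipticCurves.FineSelmerTorsionPointFieldMuRoad
import HarnessLib

/-!
# Route `KatoDescentPotSupersingular` (rung K9, sub-rung B5 = O6 wild `p = 3`, cell `bsd-potss`): per-row records on the FACT-FREE door L8 with FUKUDA'S
# TWO-LAYER ORDER TEST at the torsion-point field `ℚ(P)` — statement (A) of Coates–Sujatha at `(E, 3)` with NO named fact, and U₀ modulo `hKatoA hGZK hmod`,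
# part 01: 499230f1 (seat `bsd-potss-k9-c4` g26; `--supports stmt-BirchSwinnertonDyer-19197 --as helper`)

HONEST FRAMING. THEOREMS ONLY (no definition, no named fact, no `sorry`); PER ROW — NOT a class theorem; nothing is booked; items 19189 / 19197 / 19942 /
19386 stay OPEN at class level; Conjecture A and BSD are proved for NO class of curves.  Each theorem is CONDITIONAL on ONE displayed numerical hypothesis
about ONE octic number field and its first cyclotomic layer (class numbers; the layer under GRH), which is NOT certified in the kernel.

ROAD (door L8 of conjA-anchor g19, `CoatesSujatha2005.conjA_of_classNumberPExp_stabilizerField_succ_eq`, a KERNEL theorem; `p = 3`, `n₀ = n = 0`): `E[3]` irreducible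
(kernel `irr_g…_3`) and `Δ(E)` a CUBE (kernel) ⟹ `ρ̄_{E,3}` not onto ⟹ `3 ∤ #Gal(ℚ(E[3])/ℚ)` (Serre Prop. 15, `SmallImageDickson.not_dvd_card_aut_divisionField`) ⟹ tameness
for door L8 AND Fukuda index `0` for the cyclotomic `ℤ₃`-extension of `ℚ(P) = ℚ̄^{Stab(P)} ⊆ ℚ(E[3])`
(`CartanMuRoadFukudaDoorsTprime.totallyRamifiedFrom_zero_of_isCyclotomic_of_algHom_normal_of_not_dvd_card`) — all in the KERNEL; plus ONE DISPLAYED hypothesis `hord`: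
**for every non-zero `P ∈ E[3]` and every cyclotomic `ℤ₃`-extension `κ_P` of `ℚ(P)`: `ord₃ h(ℚ(P)₁) = ord₃ h(ℚ(P))`** ⟹ (Fukuda 1994 Thm. 1 (1) at finite level, tree theorem
inside door L8) `μ₃(ℚ(P)_cyc) = 0` with bounded ranks ⟹ statement (A) at `(E, 3)` for every cyclotomic `ℤ₃`-extension of `ℚ`; and U₀ `MissingUpperBoundAt E 3` modulo
`hKatoA hGZK hmod` + Cremona's `r_an = 0` (k8t-c4's `WildFineSelmerSupersingularCMAnchor.missingUpperBoundAt_wild_of_conjA`).  NO Ferrero–Washington, NO Iwasawa-growth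
fact, NO `K⁺ → ℚ(E[3])` transfer (this is what separates the record below from k9-c4 g23's `missingUpperBoundAt_g499230f1_3_fkK01`, which reads the SAME two class
numbers but displays `hFW`/`hI` for the transfer to `L = ℚ(E[3])`; door L8 needs `μ = 0` at `ℚ(P)` ONLY).
NUMERICS (k9-c4 g23, kit j315922 `ug8nn.gp`, PARI/GP 2.17; RESULT file `run/shared/lean/pub/bsd-potss/k9-c4/g23/kit/ug8nn/RESULT-ug8nn-j315922.txt`): for 499230f1,
`ψ₃/3 = x^4 - x^3 - 211180530x^2 - 1135589760076x - 3716150790150056` is irreducible and `K⁺ = ℚ(P) ≅ ℚ[x]/(x^8 - 2x^7 + x^6 - 32x^5 + 28x^4 + 4x^3 + 127x^2 - 194x - 125)`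
(degree 8, signature `[2,3]`, ONE prime above `3`, `e = 8`): `h(ℚ(P)) = 3` (`Cl = [3]`, `bnfcertify` = 1: CERTIFIED); first layer `ℚ(P)₁ = ℚ(P)·ℚ(ζ₉)⁺` (degree 24):
`h = 3·(prime-to-3)` — precisely `ord₃ h(ℚ(P)₁) = 1 = ord₃ h(ℚ(P))` («`Fukuda (0,1): K01e | e0=1 | e1=1 | r0=1 | r1=1`», GRH).  The identification of the Lean field
`fixedField (Stab P)` with `ℚ[x]/(octic)` is the census memos' (all `ℚ(P)`, `P ≠ 0`, are conjugate: the image `C_ns⁺(3)` — kernel certificate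
`hasModPImageEqNonsplitCartanNormalizer_g499230f1_3`, k9-c4 g23 — is transitive on `E[3] ∖ 0`), not a kernel statement.
KERNEL lemmas `isElliptic_g499230f1`, `isGloballyMinimal_g499230f1`, `irr_g499230f1_3` (`…WildUpperUnitTwistRecordsSharpP31`), `classO6_g499230f1_3` (`…ClassO626`) are IMPORTED;
`Δ_cube_g499230f1` is proved here (`norm_num`).

References: [CoatesSujatha2005] Thm. 3.4, Lemma 3.8; [Fukuda1994] Thm. 1 (1), p. 264; [Washington1997] §13.3 Lemma 13.18, Prop. 13.22–13.23; [NeukirchANT1999] Ch. IV §6,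
Ch. VI §7 Thm. (7.1); [Serre1972] §2.4 Prop. 15, §5.3; [Kato2004Asterisque] Thm. 14.5 (3), Prop. 14.16 (2); [Cremona2006] Table 1.
-/

set_option autoImplicit false
set_option linter.dupNamespace false

noncomputable section

open scoped Classical NumberField
open WeierstrassCurve NumberField Field IsDedekindDomain IntermediateField
  Literature.NumberTheory.EllipticCurves Literature.NumberTheory.EllipticCurves.Rank1Residual
  Literature.NumberTheory.EllipticCurves.Rank1Residual.Typed
  Literature.NumberTheory.GaloisRepresentations Literature.NumberTheory.NumberFields
  Literature.NumberTheory.SerreUniformity Literature.NumberTheory.IwasawaTheory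
  Summit.BirchSwinnertonDyer.Rank1Residual Summit.BirchSwinnertonDyer.Rank1Residual.Additive
  Summit.BirchSwinnertonDyer.BirchSwinnertonDyer.Theorems
  Summit.BirchSwinnertonDyer.BirchSwinnertonDyer.Theorems.AdditiveBranchIMCGordTwoRankOne
  Summit.BirchSwinnertonDyer.BirchSwinnertonDyer.Theorems.WildUpperUnitTwistRecords

namespace Summit.BirchSwinnertonDyer.BirchSwinnertonDyer.Theorems.WildFineSelmerStabilizerFukudaRecords

/-! ## §0 The road (door L8 with Fukuda's order test; Fukuda's index and tameness from `Δ` a cube) -/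

set_option synthInstance.maxHeartbeats 400000 in
set_option maxHeartbeats 4000000 in
/-- **(A) at `(W, 3)` from TWO class numbers of the torsion-point field** (fact-free road of this file): `W/ℚ` elliptic, `W[3]` irreducible, `Δ(W)` a cube
(so `ρ̄_{W,3}` is not onto and `3 ∤ #Gal(ℚ(W[3])/ℚ)`: Fukuda index `0` at `ℚ(P) ⊆ ℚ(W[3])` and tameness, all kernel), `P ∈ W[3] ∖ 0`; DISPLAYED: for every
cyclotomic `ℤ₃`-extension `κ_P` of `ℚ(P) = ℚ̄^{Stab(P)}`, `ord₃ h(ℚ(P)_{n+1}) = ord₃ h(ℚ(P)_n)`.  Then statement (A) holds for `W` at `3` over every cyclotomic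
`ℤ₃`-extension of `ℚ` (door L8 `CoatesSujatha2005.conjA_of_classNumberPExp_stabilizerField_succ_eq`: Fukuda Thm. 1 (1) at finite level ⟹ `μ = 0` ⟹ bounded ranks ⟹
Coates–Sujatha (A) via the torsion-point-field descent). [cite: CoatesSujatha2005, §3 Thm. 3.4 and Lemma 3.8] [cite: Fukuda1994, Thm. 1 (1), p. 264]
[cite: Washington1997, §13.3 Lemma 13.18 and Prop. 13.22] [cite: Serre1972, §2.4 Prop. 15, §5.3] [cite: NeukirchANT1999, Ch. IV §6 and Ch. VI §7 Thm. (7.1)] -/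
theorem conjA_three_of_Δ_eq_cube_of_classNumberPExp_stabilizerField_succ_eq (W : WeierstrassCurve ℚ) [W.IsElliptic]
    (hirr : W.HasIrreducibleModPGaloisRep 3) {d : ℚ} (hΔ : W.Δ = d ^ 3)
    (P : ↥(W.geomTorsion ((3 : ℕ) : ℤ))) (hP0 : P ≠ 0) (n : ℕ)
    (hord : ∀ κP : ZpExtension ↥(fixedField (MulAction.stabilizer (absoluteGaloisGroup ℚ) P) :
        IntermediateField ℚ (AlgebraicClosure ℚ)) 3, κP.IsCyclotomic →
        classNumberPExp κP (n + 1) = classNumberPExp κP n)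
    (κ : ZpExtension ℚ 3) (hκ : κ.IsCyclotomic) :
    ∃ (γ : absoluteGaloisGroup ℚ) (Df : W.FineSelmerDualData κ γ),
      Module.Finite ℤ_[3] (RestrictScalars ℤ_[3] (IwasawaAlgebra 3) Df.X) := by
  haveI : Fact (Nat.Prime 3) := ⟨Nat.prime_three⟩
  have hns : ¬ W.HasSurjectiveModNGaloisRep 3 := ModThreeImage.not_hasSurjectiveModNGaloisRep_three_of_Δ_eq_cube W hΔ
  have hG : ¬ 3 ∣ Nat.card ((W.divisionField 3) ≃ₐ[ℚ] (W.divisionField 3)) :=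
    SmallImageDickson.not_dvd_card_aut_divisionField W 3 hirr hns
  have hle : fixedField (MulAction.stabilizer (absoluteGaloisGroup ℚ) P) ≤ W.divisionField 3 :=
    CoatesSujatha2005.fixedField_stabilizer_le_divisionField W P
  haveI : FiniteDimensional ℚ ↥(W.divisionField 3) := W.finiteDimensional_divisionField 3
  haveI : IsGalois ℚ ↥(W.divisionField 3) := W.isGalois_divisionField 3
  haveI : FiniteDimensional ℚ ↥(fixedField (MulAction.stabilizer (absoluteGaloisGroup ℚ) P)) :=
    FiniteDimensional.of_injective (IntermediateField.inclusion hle).toLinearMap (IntermediateField.inclusion_injective hle)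
  haveI : NumberField ↥(fixedField (MulAction.stabilizer (absoluteGaloisGroup ℚ) P)) := NumberField.mk
  exact CoatesSujatha2005.conjA_of_classNumberPExp_stabilizerField_succ_eq W (by decide) hirr hG P hP0 n
    (fun κP hκP => CartanMuRoadFukudaDoorsTprime.totallyRamifiedFrom_zero_of_isCyclotomic_of_algHom_normal_of_not_dvd_card
      ↥(fixedField (MulAction.stabilizer (absoluteGaloisGroup ℚ) P)) (W.divisionField 3) 3 hG (IntermediateField.inclusion hle) κP hκP)
    hord κ hκ

set_option synthInstance.maxHeartbeats 400000 in
set_option maxHeartbeats 4000000 in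
/-- **U₀ `ord₃ #Ш(W) ≤ ord₃ #Ш(W)_an` from the same datum** (modulo the named facts `hKatoA` (Kato's fine-Selmer reading of 14.5 (3)), `hGZK`, `hmod`, and
Cremona's `r_an = 0`): `W/ℚ` minimal, `ClassO6 W 3`, `W[3]` irreducible, `Δ(W)` a cube, `P ≠ 0`, and the displayed two-layer order equality at `ℚ(P)` —
then `MissingUpperBoundAt W 3` (k8t-c4's `WildFineSelmerSupersingularCMAnchor.missingUpperBoundAt_wild_of_conjA` over the (A)-door above). CONDITIONAL; nothing booked;
BSD proved for no curve. [cite: Kato2004Asterisque, Thm. 14.5 (3) (p. 236) and Prop. 14.16 (2)] [cite: CoatesSujatha2005, §3 Thm. 3.4]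
[cite: Fukuda1994, Thm. 1 (1), p. 264] [cite: Serre1972, §2.4 Prop. 15, §5.3] -/
theorem missingUpperBoundAt_three_of_Δ_eq_cube_of_classNumberPExp_stabilizerField_succ_eq
    (hKatoA : Kato2004.rankZero_padicValNat_sha_add_padicValNat_tamagawa_le_of_additive_potGood_of_irreducible_of_fineSelmerDual_fg)
    (hGZK : rank_eq_analyticRank_of_analyticRank_le_one) (hmod : hasEntireLFunction_rat)
    (W : WeierstrassCurve ℚ) [W.IsElliptic] [W.IsGloballyMinimal] (hr : W.analyticRank = 0) (hO : ClassO6 W 3)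
    (hirr : W.HasIrreducibleModPGaloisRep 3) {d : ℚ} (hΔ : W.Δ = d ^ 3)
    (P : ↥(W.geomTorsion ((3 : ℕ) : ℤ))) (hP0 : P ≠ 0) (n : ℕ)
    (hord : ∀ κP : ZpExtension ↥(fixedField (MulAction.stabilizer (absoluteGaloisGroup ℚ) P) :
        IntermediateField ℚ (AlgebraicClosure ℚ)) 3, κP.IsCyclotomic →
        classNumberPExp κP (n + 1) = classNumberPExp κP n) :
    MissingUpperBoundAt W 3 := by
  haveI : Fact (Nat.Prime 3) := ⟨Nat.prime_three⟩
  exact WildFineSelmerSupersingularCMAnchor.missingUpperBoundAt_wild_of_conjA hKatoA hGZK hmod W hr hO hirr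
    (fun κ hκ => conjA_three_of_Δ_eq_cube_of_classNumberPExp_stabilizerField_succ_eq W hirr hΔ P hP0 n hord κ hκ)

/-! ## §1 The rows -/

/-! ### `499230f1` @ `p = 3` — `N = 499230 = 2·3^3·5·43^2`; Cremona: `r_an = 0`; O6 wild at `3`; image `3Nn` (kernel `hasModPImageEqNonsplitCartanNormalizer_g499230f1_3`, k9-c4 g23);
`Δ = (343470240)³`; `ℚ(P)` octic `x^8 - 2x^7 + x^6 - 32x^5 + 28x^4 + 4x^3 + 127x^2 - 194x - 125` (ONE prime above `3`, `h = 3` CERTIFIED; `3 ∣ h` shuts Iwasawa 1956 and the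
class of the prime above `3` does not generate `Cl/3` — door UG shut); LAYER 1 (kit j315922, GRH): `ℚ(P)₁` degree 24, `ord₃ h = 1` (`r₁ = 1`): Fukuda's ORDER test holds at
`(0,1)`.  First roads: k9-c4 g16/g17 unit-twist record `missingUpperBoundAt_g499230f1_3` (displays Heegner-side facts); k9-c4 g23 `missingUpperBoundAt_g499230f1_3_fkK01`
(same class numbers, displays `hFW hI`).  This record: NO named fact on the (A) side. -/

/-- `Δ(499230f1) = (343470240)³` — a CUBE (kernel, `norm_num`). [cite: Serre1972, §5.3] [cite: Cremona2006, Table 1 (Cremona label 499230f1)] -/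
theorem Δ_cube_g499230f1 : (⟨1, (-1), 0, (-105590265), (-283897440019)⟩ : WeierstrassCurve ℚ).Δ = (((343470240) : ℚ)) ^ 3 := by
  norm_num [WeierstrassCurve.Δ, WeierstrassCurve.b₂, WeierstrassCurve.b₄, WeierstrassCurve.b₆, WeierstrassCurve.b₈]

/-- **(A) AT `(499230f1, 3)` — NO NAMED FACT** (door L8, Fukuda order test at `ℚ(P)`, layers `(0,1)`): KERNEL `irr_g499230f1_3`, `Δ_cube_g499230f1`; DISPLAYED `hord`
(«`ord₃ h(ℚ(P)₁) = ord₃ h(ℚ(P))`», every `P ≠ 0`, every cyclotomic `κ_P`; kit j315922: `h(ℚ(P)) = 3` CERTIFIED, `ord₃ h(ℚ(P)₁) = 1` GRH). Per row; nothing booked;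
(A)/BSD proved for no class. [cite: CoatesSujatha2005, §3 Thm. 3.4 and Lemma 3.8] [cite: Fukuda1994, Thm. 1 (1), p. 264] [cite: Serre1972, §2.4 Prop. 15, §5.3]
[cite: Cremona2006, Table 1 (Cremona label 499230f1)] -/
theorem conjA_g499230f1_3_L8e
    {W : WeierstrassCurve ℚ} [W.IsElliptic] (hWeq : W = (⟨1, (-1), 0, (-105590265), (-283897440019)⟩ : WeierstrassCurve ℚ))
    (P : ↥(W.geomTorsion ((3 : ℕ) : ℤ))) (hP0 : P ≠ 0)
    (hord : ∀ κP : ZpExtension ↥(fixedField (MulAction.stabilizer (absoluteGaloisGroup ℚ) P) :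
        IntermediateField ℚ (AlgebraicClosure ℚ)) 3, κP.IsCyclotomic →
        classNumberPExp κP (0 + 1) = classNumberPExp κP 0)
    (κ : ZpExtension ℚ 3) (hκ : κ.IsCyclotomic) :
    ∃ (γ : absoluteGaloisGroup ℚ) (Df : W.FineSelmerDualData κ γ),
      Module.Finite ℤ_[3] (RestrictScalars ℤ_[3] (IwasawaAlgebra 3) Df.X) := by
  subst hWeq
  exact conjA_three_of_Δ_eq_cube_of_classNumberPExp_stabilizerField_succ_eq _ irr_g499230f1_3 Δ_cube_g499230f1 P hP0 0 hord κ hκ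

/-- **RECORD — U₀ `ord₃ #Ш(E) ≤ ord₃ #Ш(E)_an` for `E = 499230f1` at `p = 3` on the fact-free door L8 / Fukuda order test at `ℚ(P)`** (U₀-ns row of K9 items 19189 / 19197):
KERNEL `classO6_g499230f1_3`, `irr_g499230f1_3`, `Δ_cube_g499230f1`; DISPLAYED named facts `hKatoA hGZK hmod` ONLY, Cremona's `r_an = 0` (`hr`), and `hord` (kit j315922:
`h(ℚ(P)) = 3` CERT, `ord₃ h(ℚ(P)₁) = 1` GRH). Per row; nothing booked; BSD is not proved by this.
[cite: Kato2004Asterisque, Thm. 14.5 (3) (p. 236) and Prop. 14.16 (2)] [cite: CoatesSujatha2005, §3 Thm. 3.4] [cite: Fukuda1994, Thm. 1 (1), p. 264]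
[cite: Cremona2006, Table 1 (Cremona label 499230f1)] -/
theorem missingUpperBoundAt_g499230f1_3_L8e
    (hKatoA : Kato2004.rankZero_padicValNat_sha_add_padicValNat_tamagawa_le_of_additive_potGood_of_irreducible_of_fineSelmerDual_fg)
    (hGZK : rank_eq_analyticRank_of_analyticRank_le_one) (hmod : hasEntireLFunction_rat)
    {W : WeierstrassCurve ℚ} [W.IsElliptic] [W.IsGloballyMinimal] (hWeq : W = (⟨1, (-1), 0, (-105590265), (-283897440019)⟩ : WeierstrassCurve ℚ))
    (hr : W.analyticRank = 0) (P : ↥(W.geomTorsion ((3 : ℕ) : ℤ))) (hP0 : P ≠ 0)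
    (hord : ∀ κP : ZpExtension ↥(fixedField (MulAction.stabilizer (absoluteGaloisGroup ℚ) P) :
        IntermediateField ℚ (AlgebraicClosure ℚ)) 3, κP.IsCyclotomic →
        classNumberPExp κP (0 + 1) = classNumberPExp κP 0) :
    MissingUpperBoundAt W 3 := by
  subst hWeq
  exact missingUpperBoundAt_three_of_Δ_eq_cube_of_classNumberPExp_stabilizerField_succ_eq hKatoA hGZK hmod _ hr classO6_g499230f1_3 irr_g499230f1_3
    Δ_cube_g499230f1 P hP0 0 hord

end Summit.BirchSwinnertonDyer.BirchSwinnertonDyer.Theorems.WildFineSelmerStabilizerFukudaRecords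

end
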